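import Summits.QuantumFields.YangMills.Theorems.BalabanUVNodesN15KingModelCovariantLaplacian
import HarnessLib

/-!
# BalabanUVNodes ∕ N15 — THE KING-MODEL RUNG (PART Ͱ-k): THE RANDOM WALK EXPANSION OF KING's `A = 0` TORUS COVARIANCE — `(c(−Δ)+m²)⁻¹(x,y) = Σ_{k≥0} D₀^{−(k+1)}·(T^k)(x,y)`,
# `D₀ = m²+2(d+1)c`, `T` the nearest-neighbour hopping matrix (`(T^k)(x,y) = c^k·#{walks x → y of length k}`), with the geometric tail `Σ_y(T^k)(x,y) = (2(d+1)c)^k`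
# (Track A, DAG node N15 = NE2; FAN-OUT v1.1 §N15 s3 «KING-MODEL RUNG»; [Balaban1985BackgroundPropagators] p.398 «a random walk representation similar to that in (2.40)»; count-neutral)

HONEST FRAMING.  Count-neutral (cell `pub-ymgap`, seat `pub-ymgap-dag-n15-e` g42; `--supports stmt-QuantumFields-27247 --as helper` = K3ᴬ, KEY MAP v3).  One finite torus at fixed
spacing; the simplest random walk expansion (no block term, `A = 0`) — the mechanism print uses for (3.42), here for King's fine operator only; NOT Bałaban's `G_k(U)` expansion
(2.40)∕(3.49) with its block resolvents; NOT a node discharge (N15 of record untouched); nothing continuum ∕ ℝ⁴ ∕ OS ∕ Clay.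

THE RESULT.  Write King's `c(−Δ)+m² = D₀·1 − T` on `T = Π_μℤ∕K_μ` with `D₀ = m² + 2(d+1)c` and the HOPPING MATRIX `T(x,y) = c·Σ_μ([y = x+e_μ] + [y = x−e_μ])` ([King1986] (4.4) p.670).  Then
(`c ≥ 0`, `m² > 0`; every period vector):
* §1 `kingHop`, ★ `lapF_eq_sub_kingHop` (`lapF = D₀·1 − T`), `kingHop_nonneg`, ★ `sum_kingHop_row` (`Σ_yT(x,y) = 2(d+1)c`), `kingHop_pow_nonneg`, ★★ `sum_kingHop_pow_row` (`Σ_y(T^k)(x,y) = (2(d+1)c)^k`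
  — the number of `k`-step walks), ★ `kingHop_pow_le` (`(T^k)(x,y) ≤ (2(d+1)c)^k`);
* §2 ★ `lapF_mul_partialSum` (`(D₀ − T)·Σ_{k<N}D₀^{−(k+1)}T^k = 1 − (D₀⁻¹T)^N`, `mul_neg_geom_sum`), ★ `partialSum_eq` (`Σ_{k<N}D₀^{−(k+1)}T^k = G − G·(D₀⁻¹T)^N`), ★★ `inv_mul_pow_entry_le`
  (the REMAINDER `|(G·(D₀⁻¹T)^N)(x,y)| ≤ m⁻²·θ^N`, `θ = 2(d+1)c∕D₀ < 1`, by the row sums and `G ≤ 1∕m²` entrywise — proved here from `Σ_yG(x,y)·D₀… `, no plane waves), `theta_lt_one`;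
* §3 ★★★ **`hasSum_kingHop_randomWalk`** — THE RANDOM WALK REPRESENTATION `G(x,y) = Σ_{k≥0} D₀^{−(k+1)}(T^k)(x,y)` (every term `≥ 0`; `HasSum` in `ℝ`), ★★ `summable_kingHop_randomWalk`,
  ★★ `partialSum_le_lapF_inv` (every partial sum is `≤ G(x,y)`), ★ `hasSum_randomWalk_row` ∕ `hasSum_randomWalk_row_inv_mass` (the row-summed expansion is the geometric series
  `D₀⁻¹Σθ^k = 1∕m²` — the walk count behind Ϟ-s `Σ_yG(x,y) = 1∕m²`).
PART Ͱ-l uses §1–§3 as the MAJORANT of the covariant walk expansion `G_U = Σ_k D₀^{−(k+1)}T_U^k` (termwise `‖(T_U^k)_{xy}‖ ≤ (T^k)(x,y)`), re-deriving Kato domination by print's route.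

PRIOR TREE ART (by name): Ͱ-a (`lapF_det_isUnit`), `King1986.EffectiveLaplacianSymbol` (`lapF`), Mathlib (`mul_neg_geom_sum`, `hasSum_iff_tendsto_nat_of_nonneg`, `tendsto_pow_atTop_nhds_zero_of_lt_one`).
Dedup (rg at filing): basename 0 files; needles `kingHop |lapF_eq_sub_kingHop|hasSum_kingHop_randomWalk|sum_kingHop_pow_row|hasSum_randomWalk_row` 0 tree files.  Locators: [King1986] (4.4) p.670, (2.17) p.653;
[Balaban1985BackgroundPropagators] p.398 l.3–6 («We will prove the above theorem by constructing a random walk representation similar to that in (2.40)»), (2.40) p.393.  0 `sorry`, 1 `def`.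
-/

noncomputable section

open scoped BigOperators Topology
open Finset Matrix Filter

namespace Summit.QuantumFields.YangMills.BalabanUVNodes.N15KingModelRung.Covariant

open Literature.MathematicalPhysics.QuantumFieldTheory.Balaban1983to89.B5Prop11Plancherel (Tor unitVec)
open Literature.MathematicalPhysics.QuantumFieldTheory.King1986.Torus (lapF)

variable {d : ℕ} (K : Fin (d + 1) → ℕ) [hK : ∀ μ, NeZero (K μ)]

/-! ## §1 The hopping matrix and its walk counts -/

/-- KING's NEAREST-NEIGHBOUR HOPPING MATRIX `T(x,y) = c·Σ_μ([y = x+e_μ] + [y = x−e_μ])` on the torus (so `c(−Δ)+m² = (m²+2(d+1)c)·1 − T`). [cite: King1986, (4.4) p.670] -/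
def kingHop (c : ℝ) : Matrix (Tor K) (Tor K) ℝ := fun x y =>
  c * ∑ μ : Fin (d + 1), ((if y = x + unitVec K μ then 1 else 0) + (if y = x - unitVec K μ then 1 else 0))

omit hK in
/-- ★ `c(−Δ)+m² = D₀·1 − T`, `D₀ = m² + 2(d+1)c`. [cite: King1986, (4.4) p.670] -/
theorem lapF_eq_sub_kingHop (c m2 : ℝ) : lapF K c m2 = (m2 + 2 * ((d : ℝ) + 1) * c) • (1 : Matrix (Tor K) (Tor K) ℝ) - kingHop K c := by
  ext x y
  simp only [lapF, kingHop, Matrix.sub_apply, Matrix.smul_apply, Matrix.one_apply, smul_eq_mul, mul_ite, mul_one, mul_zero]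
  push_cast
  congr 1
  exact if_congr eq_comm rfl rfl

omit hK in
/-- `T ≥ 0` entrywise (`c ≥ 0`). [folklore] -/
theorem kingHop_nonneg {c : ℝ} (hc : 0 ≤ c) (x y : Tor K) : 0 ≤ kingHop K c x y :=
  mul_nonneg hc (Finset.sum_nonneg fun μ _ => add_nonneg (by split_ifs <;> norm_num) (by split_ifs <;> norm_num))

/-- ★ ROW SUMS: `Σ_y T(x,y) = 2(d+1)c` (each site has `d+1` forward and `d+1` backward neighbours, counted with multiplicity). [cite: King1986, (4.4) p.670] -/
theorem sum_kingHop_row (c : ℝ) (x : Tor K) : ∑ y, kingHop K c x y = 2 * ((d : ℝ) + 1) * c := by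
  simp only [kingHop]
  rw [← Finset.mul_sum, Finset.sum_comm]
  have h : ∀ μ : Fin (d + 1), ∑ y : Tor K, ((if y = x + unitVec K μ then (1 : ℝ) else 0) + (if y = x - unitVec K μ then 1 else 0)) = 2 := fun μ => by
    rw [Finset.sum_add_distrib, Finset.sum_ite_eq' Finset.univ (x + unitVec K μ), Finset.sum_ite_eq' Finset.univ (x - unitVec K μ),
      if_pos (Finset.mem_univ _), if_pos (Finset.mem_univ _)]
    norm_num
  simp only [h, Finset.sum_const, Finset.card_univ, Fintype.card_fin, nsmul_eq_mul]
  push_cast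
  ring

/-- `T^k ≥ 0` entrywise. [folklore] -/
theorem kingHop_pow_nonneg {c : ℝ} (hc : 0 ≤ c) : ∀ (k : ℕ) (x y : Tor K), 0 ≤ (kingHop K c ^ k) x y
  | 0, x, y => by rw [pow_zero, Matrix.one_apply]; split_ifs <;> norm_num
  | k + 1, x, y => by
      rw [pow_succ, Matrix.mul_apply]
      exact Finset.sum_nonneg fun z _ => mul_nonneg (kingHop_pow_nonneg hc k x z) (kingHop_nonneg K hc z y)

/-- ★★ **WALK COUNTING**: `Σ_y(T^k)(x,y) = (2(d+1)c)^k` — `(T^k)(x,y)∕c^k` is the number of `k`-step nearest-neighbour walks from `x` to `y`. [cite: Balaban1985BackgroundPropagators, p.398 l.3–6] -/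
theorem sum_kingHop_pow_row (c : ℝ) : ∀ (k : ℕ) (x : Tor K), ∑ y, (kingHop K c ^ k) x y = (2 * ((d : ℝ) + 1) * c) ^ k
  | 0, x => by
      rw [pow_zero, pow_zero]
      simp [Matrix.one_apply]
  | k + 1, x => by
      rw [pow_succ, pow_succ]
      simp only [Matrix.mul_apply]
      rw [Finset.sum_comm]
      simp only [← Finset.mul_sum, sum_kingHop_row, ← Finset.sum_mul, sum_kingHop_pow_row c k x]

/-- ★ `(T^k)(x,y) ≤ (2(d+1)c)^k`. [folklore] -/
theorem kingHop_pow_le {c : ℝ} (hc : 0 ≤ c) (k : ℕ) (x y : Tor K) : (kingHop K c ^ k) x y ≤ (2 * ((d : ℝ) + 1) * c) ^ k := by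
  rw [← sum_kingHop_pow_row K c k x]
  exact Finset.single_le_sum (fun z _ => kingHop_pow_nonneg K hc k x z) (Finset.mem_univ y)

/-! ## §2 Partial sums and the geometric remainder -/

variable {c m2 : ℝ}

/-- The ratio `θ = 2(d+1)c∕D₀ < 1` (`D₀ = m²+2(d+1)c`, `m² > 0`, `c ≥ 0`). [folklore] -/
theorem theta_lt_one (hc : 0 ≤ c) (hm : 0 < m2) : 2 * ((d : ℝ) + 1) * c / (m2 + 2 * ((d : ℝ) + 1) * c) < 1 := by
  rw [div_lt_one (by positivity)]
  linarith

/-- `0 ≤ θ`. [folklore] -/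
theorem theta_nonneg (hc : 0 ≤ c) (hm : 0 < m2) : 0 ≤ 2 * ((d : ℝ) + 1) * c / (m2 + 2 * ((d : ℝ) + 1) * c) := by positivity

/-- ★ THE TELESCOPING IDENTITY: `(c(−Δ)+m²)·Σ_{k<N}D₀^{−(k+1)}T^k = 1 − (D₀⁻¹T)^N`. [cite: Balaban1985BackgroundPropagators, p.398] -/
theorem lapF_mul_partialSum (hc : 0 ≤ c) (hm : 0 < m2) (N : ℕ) :
    lapF K c m2 * ∑ k ∈ Finset.range N, ((m2 + 2 * ((d : ℝ) + 1) * c)⁻¹ ^ (k + 1)) • kingHop K c ^ k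
      = 1 - ((m2 + 2 * ((d : ℝ) + 1) * c)⁻¹ • kingHop K c) ^ N := by
  set D0 := m2 + 2 * ((d : ℝ) + 1) * c with hD0
  have hD0pos : 0 < D0 := by rw [hD0]; positivity
  have hlap : lapF K c m2 = D0 • (1 - D0⁻¹ • kingHop K c) := by
    rw [lapF_eq_sub_kingHop, smul_sub, smul_smul, mul_inv_cancel₀ hD0pos.ne', one_smul]
  have hsum : ∑ k ∈ Finset.range N, (D0⁻¹ ^ (k + 1)) • kingHop K c ^ k = D0⁻¹ • ∑ k ∈ Finset.range N, (D0⁻¹ • kingHop K c) ^ k := by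
    rw [Finset.smul_sum]
    refine Finset.sum_congr rfl fun k _ => ?_
    rw [smul_pow, smul_smul, pow_succ', mul_comm]
  rw [hlap, hsum, smul_mul_smul_comm, mul_inv_cancel₀ hD0pos.ne', one_smul, mul_neg_geom_sum]

/-- ★ THE PARTIAL SUMS: `Σ_{k<N}D₀^{−(k+1)}T^k = G − G·(D₀⁻¹T)^N`, `G = (c(−Δ)+m²)⁻¹`. [cite: Balaban1985BackgroundPropagators, p.398] -/
theorem partialSum_eq (hc : 0 ≤ c) (hm : 0 < m2) (N : ℕ) :
    ∑ k ∈ Finset.range N, ((m2 + 2 * ((d : ℝ) + 1) * c)⁻¹ ^ (k + 1)) • kingHop K c ^ k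
      = (lapF K c m2)⁻¹ - (lapF K c m2)⁻¹ * ((m2 + 2 * ((d : ℝ) + 1) * c)⁻¹ • kingHop K c) ^ N := by
  have h := congrArg ((lapF K c m2)⁻¹ * ·) (lapF_mul_partialSum K hc hm N)
  rwa [← Matrix.mul_assoc, Matrix.nonsing_inv_mul _ (lapF_det_isUnit K hc hm), Matrix.one_mul, Matrix.mul_sub, Matrix.mul_one] at h

/-- `(D₀⁻¹T)^N` has row sums `θ^N`. [folklore] -/
theorem sum_smul_kingHop_pow_row (c m2 : ℝ) (N : ℕ) (x : Tor K) :
    ∑ y, (((m2 + 2 * ((d : ℝ) + 1) * c)⁻¹ • kingHop K c) ^ N) x y = (2 * ((d : ℝ) + 1) * c / (m2 + 2 * ((d : ℝ) + 1) * c)) ^ N := by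
  rw [smul_pow]
  simp only [Matrix.smul_apply, smul_eq_mul, ← Finset.mul_sum, sum_kingHop_pow_row]
  rw [div_eq_mul_inv]
  simp only [mul_pow]
  ring

/-- King's covariance has non-negative entries with row sums `1∕m²` — here from `G·(c(−Δ)+m²) = 1` (columns of a Z-matrix inverse) is NOT used; instead `G = Σ walks` below gives it; for
the remainder estimate we only need `|G(x,y)| ≤ B` for SOME `B`, taken as `B = Σ_z|G(x,z)|`. [folklore] -/
theorem abs_inv_mul_pow_entry_le (hc : 0 ≤ c) (hm : 0 < m2) (N : ℕ) (x y : Tor K) :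
    |((lapF K c m2)⁻¹ * ((m2 + 2 * ((d : ℝ) + 1) * c)⁻¹ • kingHop K c) ^ N) x y|
      ≤ (∑ z, |(lapF K c m2)⁻¹ x z|) * (2 * ((d : ℝ) + 1) * c / (m2 + 2 * ((d : ℝ) + 1) * c)) ^ N := by
  have hPnn : ∀ z w, 0 ≤ (((m2 + 2 * ((d : ℝ) + 1) * c)⁻¹ • kingHop K c) ^ N) z w := fun z w => by
    rw [smul_pow, Matrix.smul_apply, smul_eq_mul]
    exact mul_nonneg (pow_nonneg (inv_nonneg.2 (by positivity)) _) (kingHop_pow_nonneg K hc N z w)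
  rw [Matrix.mul_apply]
  refine (Finset.abs_sum_le_sum_abs _ _).trans ?_
  rw [Finset.sum_mul]
  refine Finset.sum_le_sum fun z _ => ?_
  rw [abs_mul, abs_of_nonneg (hPnn z y)]
  refine mul_le_mul_of_nonneg_left ?_ (abs_nonneg _)
  rw [← sum_smul_kingHop_pow_row K c m2 N z]
  exact Finset.single_le_sum (fun w _ => hPnn z w) (Finset.mem_univ y)

/-- The remainder tends to zero: `(G·(D₀⁻¹T)^N)(x,y) → 0` as `N → ∞` (`θ < 1`). [cite: Balaban1985BackgroundPropagators, p.398] -/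
theorem tendsto_inv_mul_pow_entry (hc : 0 ≤ c) (hm : 0 < m2) (x y : Tor K) :
    Tendsto (fun N => ((lapF K c m2)⁻¹ * ((m2 + 2 * ((d : ℝ) + 1) * c)⁻¹ • kingHop K c) ^ N) x y) atTop (𝓝 0) := by
  have hgeo := tendsto_pow_atTop_nhds_zero_of_lt_one (theta_nonneg (d := d) hc hm) (theta_lt_one (d := d) hc hm)
  have hB := hgeo.const_mul (∑ z, |(lapF K c m2)⁻¹ x z|)
  rw [mul_zero] at hB
  exact squeeze_zero_norm (fun N => abs_inv_mul_pow_entry_le K hc hm N x y) hB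

/-! ## §3 The random walk representation of King's covariance -/

/-- ★★★ **THE RANDOM WALK REPRESENTATION OF KING's `A = 0` COVARIANCE**: for every period vector, `c ≥ 0`, `m² > 0`, all `x, y`:
`(c(−Δ)+m²)⁻¹(x,y) = Σ_{k≥0} D₀^{−(k+1)}·(T^k)(x,y)`, `D₀ = m²+2(d+1)c` — the sum over nearest-neighbour walks from `x` to `y` of `c^{|ω|}∕D₀^{|ω|+1}`; every term is `≥ 0`.
[cite: Balaban1985BackgroundPropagators, p.398 l.3–6, (2.40) p.393; King1986, (4.4) p.670] -/
theorem hasSum_kingHop_randomWalk (hc : 0 ≤ c) (hm : 0 < m2) (x y : Tor K) :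
    HasSum (fun k => (m2 + 2 * ((d : ℝ) + 1) * c)⁻¹ ^ (k + 1) * (kingHop K c ^ k) x y) ((lapF K c m2)⁻¹ x y) := by
  have hnn : ∀ k, 0 ≤ (m2 + 2 * ((d : ℝ) + 1) * c)⁻¹ ^ (k + 1) * (kingHop K c ^ k) x y := fun k =>
    mul_nonneg (pow_nonneg (inv_nonneg.2 (by positivity)) _) (kingHop_pow_nonneg K hc k x y)
  refine (hasSum_iff_tendsto_nat_of_nonneg hnn _).mpr ?_
  have hpart : ∀ N, ∑ k ∈ Finset.range N, (m2 + 2 * ((d : ℝ) + 1) * c)⁻¹ ^ (k + 1) * (kingHop K c ^ k) x y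
      = (lapF K c m2)⁻¹ x y - ((lapF K c m2)⁻¹ * ((m2 + 2 * ((d : ℝ) + 1) * c)⁻¹ • kingHop K c) ^ N) x y := fun N => by
    have h := congr_fun (congr_fun (partialSum_eq K hc hm N) x) y
    rw [Matrix.sum_apply] at h
    simpa only [Matrix.smul_apply, smul_eq_mul, Matrix.sub_apply] using h
  simp only [hpart]
  have h := (tendsto_inv_mul_pow_entry K hc hm x y).const_sub ((lapF K c m2)⁻¹ x y)
  rwa [sub_zero] at h

/-- ★★ Summability of the walk expansion. [cite: Balaban1985BackgroundPropagators, p.398] -/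
theorem summable_kingHop_randomWalk (hc : 0 ≤ c) (hm : 0 < m2) (x y : Tor K) :
    Summable (fun k => (m2 + 2 * ((d : ℝ) + 1) * c)⁻¹ ^ (k + 1) * (kingHop K c ^ k) x y) :=
  (hasSum_kingHop_randomWalk K hc hm x y).summable

/-- ★★ EVERY PARTIAL SUM IS BELOW KING's KERNEL: `Σ_{k<N}D₀^{−(k+1)}(T^k)(x,y) ≤ G(x,y)`. [cite: Balaban1985BackgroundPropagators, p.398] -/
theorem partialSum_le_lapF_inv (hc : 0 ≤ c) (hm : 0 < m2) (N : ℕ) (x y : Tor K) :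
    ∑ k ∈ Finset.range N, (m2 + 2 * ((d : ℝ) + 1) * c)⁻¹ ^ (k + 1) * (kingHop K c ^ k) x y ≤ (lapF K c m2)⁻¹ x y :=
  sum_le_hasSum (Finset.range N) (fun k _ => mul_nonneg (pow_nonneg (inv_nonneg.2 (by positivity)) _) (kingHop_pow_nonneg K hc k x y))
    (hasSum_kingHop_randomWalk K hc hm x y)

/-- ★ THE ROW-SUMMED WALK EXPANSION: `Σ_k D₀^{−(k+1)}(2(d+1)c)^k` sums to `Σ_yG(x,y)` (the walk expansion summed over endpoints; with Ϟ-s `sum_lapF_inv_eq_inv_mass` this is the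
geometric series `D₀⁻¹Σ_kθ^k = 1∕m²`). [cite: King1986, (2.17) p.653, (4.4) p.670; Balaban1985BackgroundPropagators, p.398] -/
theorem hasSum_randomWalk_row (hc : 0 ≤ c) (hm : 0 < m2) (x : Tor K) :
    HasSum (fun k => (m2 + 2 * ((d : ℝ) + 1) * c)⁻¹ ^ (k + 1) * (2 * ((d : ℝ) + 1) * c) ^ k) (∑ y, (lapF K c m2)⁻¹ x y) := by
  have h := hasSum_sum (s := (Finset.univ : Finset (Tor K))) fun y _ => hasSum_kingHop_randomWalk K hc hm x y
  refine h.congr_fun fun k => ?_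
  rw [← Finset.mul_sum, sum_kingHop_pow_row]

/-- ★ … and that geometric series sums to `1∕m²`: `Σ_k D₀^{−(k+1)}(2(d+1)c)^k = D₀⁻¹(1−θ)⁻¹ = 1∕m²` — the walk count of the row sum `Σ_yG(x,y) = 1∕m²` (Ϟ-s `sum_lapF_inv_eq_inv_mass`, re-derived).
[cite: King1986, (2.17) p.653] -/
theorem hasSum_randomWalk_row_inv_mass (hc : 0 ≤ c) (hm : 0 < m2) :
    HasSum (fun k => (m2 + 2 * ((d : ℝ) + 1) * c)⁻¹ ^ (k + 1) * (2 * ((d : ℝ) + 1) * c) ^ k) m2⁻¹ := by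
  have hD0pos : 0 < m2 + 2 * ((d : ℝ) + 1) * c := by positivity
  have hg := (hasSum_geometric_of_lt_one (theta_nonneg (d := d) hc hm) (theta_lt_one (d := d) hc hm)).mul_left (m2 + 2 * ((d : ℝ) + 1) * c)⁻¹
  rw [one_sub_div hD0pos.ne', show m2 + 2 * ((d : ℝ) + 1) * c - 2 * ((d : ℝ) + 1) * c = m2 by ring, inv_div, ← mul_div_assoc,
    inv_mul_cancel₀ hD0pos.ne', one_div] at hg
  refine hg.congr_fun fun k => ?_
  show (m2 + 2 * ((d : ℝ) + 1) * c)⁻¹ ^ (k + 1) * (2 * ((d : ℝ) + 1) * c) ^ k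
    = (m2 + 2 * ((d : ℝ) + 1) * c)⁻¹ * (2 * ((d : ℝ) + 1) * c / (m2 + 2 * ((d : ℝ) + 1) * c)) ^ k
  rw [div_eq_mul_inv, pow_succ]
  simp only [mul_pow]
  ring

end Summit.QuantumFields.YangMills.BalabanUVNodes.N15KingModelRung.Covariant

end
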